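import Summits.Ventures.HodgeRepro.TwistStabilizer

/-!
# Orbit sizes of type squares under the Galois twists — every finite `(G, c)` (seat `p1`, gen 4)

Blind re-derivation cell `pub-hodge-repro`.  Continues `TwistStabilizer.lean` (squares `typeSquare`, twists `rmulSet`,
the stabiliser lemma `eq_one_or_involution_of_fix`, `fix_unique`).  Here `G` is finite:

* `stabilizerSet S` — the twists fixing `S`, as a finset; `card_stabilizerSet_le_two` for a type square (given a third
  place, which `exists_third_place` provides as soon as `4 < |G|`);
* `op_smul_eq_rmul` / `op_smul_eq_rmulSet` — the twist is Mathlib's pointwise right action of `Gᵐᵒᵖ`;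
* `card_orbitSet_mul_card_stabilizerSet` — orbit–stabiliser for the twists (`MulAction.orbitProdStabilizerEquivGroup`);
* **`card_orbitSet_typeSquare`** — the orbit of a type square has `|G|` or `|G|/2` elements.

The sealed census lists, for eleven `(G, c)` of order 6, 8, 12, orbits of exactly these two sizes; `FaceOrbitRows*.lean`
certify the counts (`ι·2^(m/2−2)` orbits of size `|G|/2`, `ι` = number of involutions other than `c`).  Paper proof:
`proofs/P1.md` §8.
-/

open Finset

namespace HodgeRepro.TwistOrbit

variable {G : Type*} [Group G] [DecidableEq G]

open scoped Pointwise

/-- Mathlib's pointwise right action of `Gᵐᵒᵖ` on a set of embeddings is the Galois twist `rmul`. -/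
theorem op_smul_eq_rmul (Ψ : Finset G) (h : G) : MulOpposite.op h • Ψ = rmul Ψ h := by
  ext x
  rw [mem_smul_finset, mem_rmul]
  constructor
  · rintro ⟨y, hy, rfl⟩
    rw [op_smul_eq_mul, mul_inv_cancel_right]
    exact hy
  · intro hx
    exact ⟨x * h⁻¹, hx, by rw [op_smul_eq_mul, inv_mul_cancel_right]⟩

/-- Mathlib's pointwise right action of `Gᵐᵒᵖ` on a set of types is `rmulSet`. -/
theorem op_smul_eq_rmulSet (S : Finset (Finset G)) (h : G) : MulOpposite.op h • S = rmulSet S h := by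
  ext Ψ
  simp only [mem_smul_finset, rmulSet, mem_image, op_smul_eq_rmul]

variable [Fintype G]

/-- The stabiliser of a set of types under the Galois twists, as a finset of group elements. -/
def stabilizerSet (S : Finset (Finset G)) : Finset G := univ.filter fun g => rmulSet S g = S

/-- Membership in the stabiliser. -/
theorem mem_stabilizerSet {S : Finset (Finset G)} {g : G} : g ∈ stabilizerSet S ↔ rmulSet S g = S := by
  simp [stabilizerSet]

/-- The stabiliser of a type square has at most two elements. -/
theorem card_stabilizerSet_le_two {c : G} (hc : IsComplexConj c) {Φ : Finset G} (hΦ : IsCMType c Φ) {p p' : G}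
    (hpp' : p' ∉ place c p) (hq : ∃ q, q ∉ place c p ∧ q ∉ place c p') :
    (stabilizerSet (typeSquare c Φ p p')).card ≤ 2 := by
  by_cases hex : ∃ g ∈ stabilizerSet (typeSquare c Φ p p'), g ≠ 1
  · obtain ⟨g₀, hg₀, hg₀1⟩ := hex
    have hsub : stabilizerSet (typeSquare c Φ p p') ⊆ {1, g₀} := by
      intro g hg
      rw [mem_insert, mem_singleton]
      by_cases h1 : g = 1
      · exact Or.inl h1
      · exact Or.inr (fix_unique hc hΦ hpp' hq (mem_stabilizerSet.1 hg) (mem_stabilizerSet.1 hg₀) h1 hg₀1)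
    exact (card_le_card hsub).trans (card_le_two)
  · have hsub : stabilizerSet (typeSquare c Φ p p') ⊆ {1} := by
      intro g hg
      rw [mem_singleton]
      by_contra h1
      exact hex ⟨g, hg, h1⟩
    exact (card_le_card hsub).trans (by simp)

/-- A third place exists as soon as `G` has more than four elements. -/
theorem exists_third_place {c : G} (h4 : 4 < Fintype.card G) (p p' : G) :
    ∃ q, q ∉ place c p ∧ q ∉ place c p' := by
  by_contra hcon
  have hsub : (univ : Finset G) ⊆ place c p ∪ place c p' := by
    intro q _
    rw [mem_union]
    by_contra hq
    rw [not_or] at hq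
    exact hcon ⟨q, hq.1, hq.2⟩
  have hcard : Fintype.card G ≤ 4 := by
    have h1 : (place c p).card ≤ 2 := by
      unfold place; exact (card_insert_le _ _).trans (by simp)
    have h2 : (place c p').card ≤ 2 := by
      unfold place; exact (card_insert_le _ _).trans (by simp)
    calc Fintype.card G = (univ : Finset G).card := (card_univ).symm
      _ ≤ (place c p ∪ place c p').card := card_le_card hsub
      _ ≤ (place c p).card + (place c p').card := card_union_le _ _
      _ ≤ 4 := by omega
  omega


/-! ### Orbit sizes: `|G|` or `|G|/2` (orbit–stabiliser, through Mathlib's right action of `Gᵐᵒᵖ`) -/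

/-- `op g` stabilises `S` (Mathlib's stabiliser) iff `g ∈ stabilizerSet S`. -/
theorem op_mem_stabilizer_iff (S : Finset (Finset G)) (g : G) :
    MulOpposite.op g ∈ MulAction.stabilizer Gᵐᵒᵖ S ↔ g ∈ stabilizerSet S := by
  rw [MulAction.mem_stabilizer_iff, op_smul_eq_rmulSet, mem_stabilizerSet]

/-- Mathlib's stabiliser of `S` in `Gᵐᵒᵖ` and the finset `stabilizerSet S` are in bijection (`unop`). -/
def stabilizerEquiv (S : Finset (Finset G)) :
    MulAction.stabilizer Gᵐᵒᵖ S ≃ {g : G // g ∈ stabilizerSet S} where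
  toFun x := ⟨x.1.unop, (op_mem_stabilizer_iff S x.1.unop).1 (by rw [MulOpposite.op_unop]; exact x.2)⟩
  invFun g := ⟨MulOpposite.op g.1, (op_mem_stabilizer_iff S g.1).2 g.2⟩
  left_inv x := by ext; simp
  right_inv g := by ext; simp

/-- The orbit of a set of types under the Galois twists, as a finset. -/
def orbitSet (S : Finset (Finset G)) : Finset (Finset (Finset G)) := univ.image (rmulSet S)

/-- The finset orbit coincides with Mathlib's orbit under `Gᵐᵒᵖ`. -/
theorem coe_orbitSet (S : Finset (Finset G)) : (orbitSet S : Set (Finset (Finset G))) = MulAction.orbit Gᵐᵒᵖ S := by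
  ext T
  simp only [orbitSet, coe_image, coe_univ, Set.image_univ, Set.mem_range, MulAction.mem_orbit_iff]
  constructor
  · rintro ⟨g, rfl⟩
    exact ⟨MulOpposite.op g, op_smul_eq_rmulSet S g⟩
  · rintro ⟨h, rfl⟩
    exact ⟨h.unop, by rw [← op_smul_eq_rmulSet, MulOpposite.op_unop]⟩

/-- **Orbit–stabiliser** for the Galois twists: `#orbit · #stabiliser = |G|`. -/
theorem card_orbitSet_mul_card_stabilizerSet (S : Finset (Finset G)) :
    (orbitSet S).card * (stabilizerSet S).card = Fintype.card G := by
  have h1 : Nat.card (MulAction.orbit Gᵐᵒᵖ S) * Nat.card (MulAction.stabilizer Gᵐᵒᵖ S) = Nat.card Gᵐᵒᵖ := by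
    rw [← Nat.card_prod]
    exact Nat.card_congr (MulAction.orbitProdStabilizerEquivGroup Gᵐᵒᵖ S)
  have h2 : Nat.card (MulAction.orbit Gᵐᵒᵖ S) = (orbitSet S).card := by
    rw [← Nat.card_eq_finsetCard, ← coe_orbitSet]
    rfl
  have h3 : Nat.card (MulAction.stabilizer Gᵐᵒᵖ S) = (stabilizerSet S).card := by
    rw [Nat.card_congr (stabilizerEquiv S), Nat.card_eq_finsetCard]
  have h4 : Nat.card Gᵐᵒᵖ = Fintype.card G := by
    rw [Nat.card_congr MulOpposite.opEquiv.symm, Nat.card_eq_fintype_card]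
  rw [← h2, ← h3, h1, h4]

/-- The identity twist stabilises every set of types. -/
theorem one_mem_stabilizerSet (S : Finset (Finset G)) : (1 : G) ∈ stabilizerSet S := by
  rw [mem_stabilizerSet, rmulSet]
  simp only [rmul_one, image_id']

/-- **Orbit sizes.** With at least three places, the orbit of a type square under the Galois twists has `|G|` or
`|G|/2` elements (the stabiliser being trivial or of order two). -/
theorem card_orbitSet_typeSquare {c : G} (hc : IsComplexConj c) {Φ : Finset G} (hΦ : IsCMType c Φ) {p p' : G}
    (hpp' : p' ∉ place c p) (hq : ∃ q, q ∉ place c p ∧ q ∉ place c p') :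
    (orbitSet (typeSquare c Φ p p')).card = Fintype.card G ∨
      2 * (orbitSet (typeSquare c Φ p p')).card = Fintype.card G := by
  have hos := card_orbitSet_mul_card_stabilizerSet (typeSquare c Φ p p')
  have hle := card_stabilizerSet_le_two hc hΦ hpp' hq
  have hge : 1 ≤ (stabilizerSet (typeSquare c Φ p p')).card :=
    card_pos.2 ⟨1, one_mem_stabilizerSet _⟩
  have h12 : (stabilizerSet (typeSquare c Φ p p')).card = 1 ∨
      (stabilizerSet (typeSquare c Φ p p')).card = 2 := by omega
  rcases h12 with h12 | h12
  · left; rw [h12, mul_one] at hos; exact hos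
  · right; rw [h12] at hos; rw [mul_comm]; exact hos

end HodgeRepro.TwistOrbit
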